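import Summits.KontsevichZagierPeriods.KontsevichZagierPeriods.Theses.FurushoPentagon
import Summits.KontsevichZagierPeriods.KontsevichZagierPeriods.Theorems.FurushoPentagonReducedPeriodRingLinStokesSymDefs
import Summits.KontsevichZagierPeriods.KontsevichZagierPeriods.Theorems.FurushoPentagonReducedPeriodRingSubdivGeneration
import Summits.KontsevichZagierPeriods.KontsevichZagierPeriods.Theorems.FurushoPentagonReducedPeriodRingReflectionGeneration
import Summits.KontsevichZagierPeriods.KontsevichZagierPeriods.Theorems.FurushoPentagonLinStokesSymCovDet
import Summits.KontsevichZagierPeriods.KontsevichZagierPeriods.Theorems.FurushoPentagonLinStokesSymCovHomotopy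
import Summits.KontsevichZagierPeriods.KontsevichZagierPeriods.Theorems.FurushoPentagonLinStokesSymCovClosed
import Summits.KontsevichZagierPeriods.KontsevichZagierPeriods.Theorems.FurushoPentagonSectorToKernelStokesSpanCalibration
import Literature.NumberTheory.Transcendental.KZCubicalCalculus
import Literature.NumberTheory.Transcendental.KZProductIdeal
import Literature.NumberTheory.Transcendental.SemialgebraicMapsProofs
import Literature.NumberTheory.Transcendental.SemialgebraicLineDeriv
import Mathlib.LinearAlgebra.Matrix.Adjugate

/-!
# `ReducedPeriodRing`, line `lin-stokes-sym`: face-preserving and hyperoctahedral changes of variables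

Helper file for the stub `stub_covGeneration` of crux `FurushoPentagon.ReducedPeriodRing`
(stmt-KontsevichZagierPeriods-3929), line `lin-stokes-sym`. Two classes of changes of variables of
the cube `[0,1]ⁿ` are put into Ayoub's relation module with symmetries
`linStokesSymIdeal = closure (Lin ∪ StokesLast ∪ Sym)`:

* `of_sub_of_mem_of_facePreserving` — for `Φ` with coordinates analytic near the cube and
  `ℚ`-semialgebraic on it, mapping the cube into the cube and PRESERVING EVERY FACET
  (`x_j = 0 ⇒ Φ_j(x) = 0`, `x_j = 1 ⇒ Φ_j(x) = 1`; no injectivity needed), and tame cubes `r₁, r₂`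
  with `r₁ = r₂(Φ)·det DΦ` on the cube (the SIGNED Jacobian): `[r₁] − [r₂] ∈ linStokesSymIdeal`.
  Proof: along the straight-line homotopy `φ = (1 − y)x + yΦ(x)` the pulled-back volume form has
  components `B`, `A_j` (`…LinStokesSymCovHomotopy`) with `∂_y B = Σⱼ ∂ⱼ A_j`
  (`…LinStokesSymCovClosed`); Newton–Leibniz along `y` turns `[∂_y B]` into
  `[B(·,1) − B(·,0)] = [r₂(Φ) det DΦ − r₂]`, iterated linearity turns `[∂_y B]` into
  `Σⱼ [∂ⱼ A_j]`, and each `[∂ⱼ A_j]` vanishes: a coordinate symmetry `(j last)` followed by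
  Newton–Leibniz along the new last coordinate, whose boundary values `A_j|_{x_j = 0, 1}` are zero
  because `Φ` preserves the facets.
* `of_sub_of_mem_of_hyperoctahedral` — for a hyperoctahedral map
  `h(x)_j = 1 − x_{σ j}` (`j ∈ T`) resp. `x_{σ j}` (`j ∉ T`) and tame cubes with `R = S ∘ h` on the
  cube: `[R] − [S] ∈ linStokesSymIdeal` (a symmetry generator and one reflection
  `…ReducedPeriodRingReflectionGeneration` per flipped coordinate).

References: M. Kontsevich, D. Zagier, *Periods* (2001), §1.2 rules (1)–(3); J. Ayoub, *Periods
and the conjectures of Grothendieck and Kontsevich–Zagier*, EMS Newsl. 91 (2014), Def. 10.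
-/

noncomputable section

namespace Summit.KontsevichZagierPeriods.FurushoPentagon.ReducedPeriodRing.LinStokesSym

open Set MeasureTheory
open Literature.NumberTheory.Transcendental
open Literature.NumberTheory.Transcendental.KZ
open Summit.KontsevichZagierPeriods.FurushoPentagon.SectorToKernel

/-- The volume component `B(x, y) = f(φ(x,y))·det ∂ₓφ(x,y)` of the pulled-back form along the
straight-line homotopy `φ(x, y) = (1 − y)x + yΦ(x)` on `ℝⁿ⁺¹ ∋ (x, y)` (file-local notation). -/
local notation3 (prettyPrint := false) "B[" n ", " Φ ", " f "]" => fun w : Fin (n + 1) → ℝ =>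
  f (fun i : Fin n => (1 - w (Fin.last n)) * w (Fin.castSucc i) + w (Fin.last n) * Φ (Fin.init w) i) *
    (Matrix.of fun i k : Fin n => (1 - w (Fin.last n)) * (if i = k then (1 : ℝ) else 0) +
      w (Fin.last n) * fderiv ℝ (fun x => Φ x i) (Fin.init w) (Pi.single k 1)).det

/-- The face components `A_j(x, y) = f(φ(x,y))·det (∂ₓφ)[col j ↦ ∂_yφ](x,y)` of the pulled-back
form along the straight-line homotopy (file-local notation). -/
local notation3 (prettyPrint := false) "A[" n ", " Φ ", " f "]" =>
  fun (j : Fin n) (w : Fin (n + 1) → ℝ) =>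
  f (fun i : Fin n => (1 - w (Fin.last n)) * w (Fin.castSucc i) + w (Fin.last n) * Φ (Fin.init w) i) *
    ((Matrix.of fun i k : Fin n => (1 - w (Fin.last n)) * (if i = k then (1 : ℝ) else 0) +
      w (Fin.last n) * fderiv ℝ (fun x => Φ x i) (Fin.init w) (Pi.single k 1)).updateCol j
      (fun i : Fin n => Φ (Fin.init w) i - w (Fin.castSucc i))).det

namespace CovGeneration

open SubdivGeneration (analyticOnNhd_apply isTameCube_reindex analyticOnNhd_comp_perm
  isSemialgebraicFunOn_comp_perm comp_swap_snoc)

/-! ### Face-preserving changes of variables -/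

/-- **Face-preserving change of variables from Lin + StokesLast + Sym.** For `Φ` with coordinates
analytic near `[0,1]ⁿ` and `ℚ`-semialgebraic on it, mapping the cube into the cube and preserving
every facet, and tame cubes `r₁, r₂` with `r₁(x) = r₂(Φ x)·det DΦ(x)` on the cube,
`[r₁] − [r₂] ∈ linStokesSymIdeal`: with `R = [[0,1]ⁿ⁺¹, ∂_y B]`, `R' = [[0,1]ⁿ, B(·,1) − B(·,0)]`,
`S_j = [[0,1]ⁿ⁺¹, ∂_last (A_j ∘ τ_j)]`, `τ_j = (j last)`, it is
`([r₁] − [R'] − [r₂]) − ([R] − [R']) + ([R] − Σⱼ [S_j.reindex τ_j]) + Σⱼ [S_j.reindex τ_j]`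
(Lin; StokesLast with primitive `B`; iterated Lin via `∂_y B = Σⱼ ∂ⱼ A_j`; Sym and StokesLast with
primitive `A_j ∘ τ_j` and zero boundary values).
[Kontsevich–Zagier 2001, §1.2 rules (1)–(3); Ayoub 2014, Def. 10] -/
theorem of_sub_of_mem_of_facePreserving {n : ℕ} {Φ : (Fin n → ℝ) → (Fin n → ℝ)}
    (hΦa : ∀ i, AnalyticOnNhd ℝ (fun x => Φ x i) (cube n))
    (hΦs : ∀ i, IsSemialgebraicFunOn ℚ (cube n) (fun x => Φ x i))
    (hΦm : MapsTo Φ (cube n) (cube n))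
    (hface0 : ∀ x ∈ cube n, ∀ j, x j = 0 → Φ x j = 0)
    (hface1 : ∀ x ∈ cube n, ∀ j, x j = 1 → Φ x j = 1)
    {r₁ r₂ : IntegralRep n} (h₁ : r₁.IsTameCube) (h₂ : r₂.IsTameCube)
    (hcov : ∀ x ∈ cube n, r₁.integrand x = r₂.integrand (Φ x) * (fderiv ℝ Φ x).det) :
    of r₁ - of r₂ ∈ linStokesSymIdeal := by
  obtain ⟨B, hB⟩ : ∃ B : (Fin (n + 1) → ℝ) → ℝ, B = B[n, Φ, r₂.integrand] := ⟨_, rfl⟩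
  obtain ⟨A, hA⟩ : ∃ A : Fin n → (Fin (n + 1) → ℝ) → ℝ, A = A[n, Φ, r₂.integrand] := ⟨_, rfl⟩
  obtain ⟨⟨hBa, hBs⟩, hAas⟩ := sideConditions hΦa hΦs hΦm h₂.2 h₂.isSemialgebraicFunOn hB hA
  have hΦd : ∀ i, ∀ x ∈ cube n, DifferentiableAt ℝ (fun z => Φ z i) x :=
    fun i x hx => (hΦa i x hx).differentiableAt
  -- `R = [[0,1]ⁿ⁺¹, ∂_y B]`
  have hB'a := stokesCal_analyticOnNhd_fderiv_apply hBa (Pi.single (Fin.last n) 1)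
  obtain ⟨R, hRd, hRi⟩ : ∃ R : IntegralRep (n + 1), R.domain = cube (n + 1) ∧
      R.integrand = fun w => fderiv ℝ B w (Pi.single (Fin.last n) 1) :=
    ⟨IntegralRep.tameCube _ hB'a (stokesCal_isSemialgebraicFunOn_fderiv_last hBa hBs), rfl, rfl⟩
  have hRt : R.IsTameCube := ⟨hRd, by rw [hRi]; exact hB'a⟩
  -- `R' = [[0,1]ⁿ, B(·,1) − B(·,0)]`
  have hmaps : ∀ a : ℝ, 0 ≤ a → a ≤ 1 →
      MapsTo (fun x : Fin n → ℝ => (Fin.snoc x a : Fin (n + 1) → ℝ)) (cube n) (cube (n + 1)) :=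
    fun a h0 h1 x hx => snoc_mem_cube_iff.2 ⟨hx, h0, h1⟩
  have hga : AnalyticOnNhd ℝ (fun x : Fin n → ℝ => B (Fin.snoc x 1) - B (Fin.snoc x 0)) (cube n) :=
    (hBa.comp ((stokesCal_analyticOnNhd_snoc n 1).mono (subset_univ _))
      (hmaps 1 zero_le_one le_rfl)).sub
      (hBa.comp ((stokesCal_analyticOnNhd_snoc n 0).mono (subset_univ _))
        (hmaps 0 le_rfl zero_le_one))
  have hgs : IsSemialgebraicFunOn ℚ (cube n)
      (fun x : Fin n → ℝ => B (Fin.snoc x 1) - B (Fin.snoc x 0)) := by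
    have h1 := IsSemialgebraicFunOn.comp_isSemialgebraicMapOn_holds hBs
      (stokesCal_isSemialgebraicMapOn_snoc n 1)
      (by simpa only [Rat.cast_one] using hmaps 1 zero_le_one le_rfl)
    have h0 := IsSemialgebraicFunOn.comp_isSemialgebraicMapOn_holds hBs
      (stokesCal_isSemialgebraicMapOn_snoc n 0)
      (by simpa only [Rat.cast_zero] using hmaps 0 le_rfl zero_le_one)
    simpa only [Rat.cast_one, Rat.cast_zero, Function.comp_def] using h1.fun_sub h0
  obtain ⟨R', hR'd, hR'i⟩ : ∃ R' : IntegralRep n, R'.domain = cube n ∧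
      R'.integrand = fun x => B (Fin.snoc x 1) - B (Fin.snoc x 0) :=
    ⟨IntegralRep.tameCube _ hga hgs, rfl, rfl⟩
  have hR't : R'.IsTameCube := ⟨hR'd, by rw [hR'i]; exact hga⟩
  -- StokesLast with primitive `B`: `[R] − [R']`; Lin: `[r₁] − [R'] − [r₂]`
  have hSt : of R - of R' ∈ linStokesSymIdeal := by
    refine cubicalStokesGens_subset_linStokesSymIdeal (mem_cubicalStokesGens hRt hR't hBa hBs
      (fun x hx t ht => ?_) fun x _ => by rw [hR'i])
    rw [hRi]
    exact stokesCal_hasDerivAt_snoc (hBa _ (snoc_mem_cube_iff.2 ⟨hx, ht.1, ht.2⟩)).differentiableAt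
  have hL : of r₁ - of R' - of r₂ ∈ linStokesSymIdeal := by
    refine cubicalLinGens_subset_linStokesSymIdeal (mem_cubicalLinGens h₁ hR't h₂ fun x hx => ?_)
    rw [Pi.add_apply, hcov x hx, hR'i]
    simp only [volForm_snoc_one hB (fun i => hΦd i x hx), volForm_snoc_zero hB]
    ring
  -- the face terms `S_j = [[0,1]ⁿ⁺¹, ∂_last (A_j ∘ τ_j)]`, `τ_j = (j last)`
  have hGa : ∀ j, AnalyticOnNhd ℝ (fun w : Fin (n + 1) → ℝ =>
      A j (fun i => w (Equiv.swap (Fin.castSucc j) (Fin.last n) i))) (cube (n + 1)) :=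
    fun j => analyticOnNhd_comp_perm (hAas j).1 _
  have hGs : ∀ j, IsSemialgebraicFunOn ℚ (cube (n + 1)) (fun w : Fin (n + 1) → ℝ =>
      A j (fun i => w (Equiv.swap (Fin.castSucc j) (Fin.last n) i))) :=
    fun j => isSemialgebraicFunOn_comp_perm (hAas j).2 _
  have hG'a := fun j => stokesCal_analyticOnNhd_fderiv_apply (hGa j) (Pi.single (Fin.last n) 1)
  obtain ⟨S, hStame, hSi⟩ : ∃ S : Fin n → IntegralRep (n + 1), (∀ j, (S j).IsTameCube) ∧
      ∀ j, (S j).integrand = fun w => fderiv ℝ (fun w : Fin (n + 1) → ℝ =>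
        A j (fun i => w (Equiv.swap (Fin.castSucc j) (Fin.last n) i))) w
          (Pi.single (Fin.last n) 1) :=
    ⟨fun j => IntegralRep.tameCube _ (hG'a j)
        (stokesCal_isSemialgebraicFunOn_fderiv_last (hGa j) (hGs j)),
      fun j => IntegralRep.isTameCube_tameCube _ _ _, fun j => rfl⟩
  have hbd : ∀ j, ∀ x ∈ cube n,
      A j (fun i => (Fin.snoc x 1 : Fin (n + 1) → ℝ) (Equiv.swap (Fin.castSucc j) (Fin.last n) i)) =
        A j (fun i => (Fin.snoc x 0 : Fin (n + 1) → ℝ)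
          (Equiv.swap (Fin.castSucc j) (Fin.last n) i)) := by
    intro j x hx
    rw [comp_swap_snoc, comp_swap_snoc]
    obtain ⟨h1, h0⟩ := faceForm_snoc_update_eq_zero hA (fun x hx => hface0 x hx j)
      (fun x hx => hface1 x hx j) (hΦd j) hx
    rw [h1, h0]
  have hSmem : ∀ j, of ((S j).reindex (Equiv.swap (Fin.castSucc j) (Fin.last n))) ∈
      linStokesSymIdeal :=
    fun j => (of_reindex_mem_of_boundary_eq (hGa j) (hGs j) (hStame j) (hSi j) (hbd j) _).2
  -- the closedness identity `∂_y B = Σⱼ ∂ⱼ A_j`: `R = Σⱼ S_j.reindex τ_j` on the cube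
  have hsum : EqOn R.integrand (fun w => ∑ j,
      ((S j).reindex (Equiv.swap (Fin.castSucc j) (Fin.last n))).integrand w) (cube (n + 1)) := by
    intro w hw
    have hw' : Fin.init w ∈ cube n ∧ 0 ≤ w (Fin.last n) ∧ w (Fin.last n) ≤ 1 := by
      have h := hw
      rw [cube_succ_eq] at h
      exact h
    have key := fderiv_volForm_eq_sum hB hA hΦa hΦm h₂.2 hBa (fun j => (hAas j).1) hw'.1
      ⟨hw'.2.1, hw'.2.2⟩
    rw [Fin.snoc_init_self] at key
    simp only [hRi, hSi, IntegralRep.reindex_integrand]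
    rw [key]
    exact Finset.sum_congr rfl fun j _ =>
      fderiv_apply_single_eq_comp_swap (Fin.castSucc j) ((hAas j).1 w hw).differentiableAt
  have hLin := of_sub_sum_of_mem Finset.univ
    (fun j => (S j).reindex (Equiv.swap (Fin.castSucc j) (Fin.last n)))
    (fun j _ => isTameCube_reindex (hStame j) _) R hRt hsum
  have hSum : ∑ j, of ((S j).reindex (Equiv.swap (Fin.castSucc j) (Fin.last n))) ∈
      linStokesSymIdeal :=
    AddSubgroup.sum_mem _ fun j _ => hSmem j
  rw [show of r₁ - of r₂ = (of r₁ - of R' - of r₂) - (of R - of R') +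
      (of R - ∑ j, of ((S j).reindex (Equiv.swap (Fin.castSucc j) (Fin.last n)))) +
      ∑ j, of ((S j).reindex (Equiv.swap (Fin.castSucc j) (Fin.last n))) by abel]
  exact linStokesSymIdeal.add_mem
    (linStokesSymIdeal.add_mem (linStokesSymIdeal.sub_mem hL hSt) hLin) hSum

/-! ### Hyperoctahedral changes of variables -/

/-- **Side conditions of a coordinate reflection map** `ρ_T(x)_j = 1 − x_j` (`j ∈ T`), `x_j`
(`j ∉ T`): it maps the cube into the cube, and `g ∘ ρ_T` is analytic near the cube and
`ℚ`-semialgebraic on it when `g` is. [Bochnak–Coste–Roy 1998, Prop. 2.2.6] -/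
theorem reflect_sideConditions {n : ℕ} (T : Finset (Fin n)) {g : (Fin n → ℝ) → ℝ}
    (hga : AnalyticOnNhd ℝ g (cube n)) (hgs : IsSemialgebraicFunOn ℚ (cube n) g) :
    MapsTo (fun x : Fin n → ℝ => fun j => if j ∈ T then 1 - x j else x j) (cube n) (cube n) ∧
    AnalyticOnNhd ℝ (fun x : Fin n → ℝ => g (fun j => if j ∈ T then 1 - x j else x j)) (cube n) ∧
    IsSemialgebraicFunOn ℚ (cube n)
      (fun x : Fin n → ℝ => g (fun j => if j ∈ T then 1 - x j else x j)) := by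
  have hρm : MapsTo (fun x : Fin n → ℝ => fun j => if j ∈ T then 1 - x j else x j)
      (cube n) (cube n) := by
    intro x hx j
    by_cases hj : j ∈ T
    · simp only [hj, if_true]; exact ⟨by linarith [(hx j).2], by linarith [(hx j).1]⟩
    · simp only [hj, if_false]; exact hx j
  have hρa : ∀ j, AnalyticOnNhd ℝ (fun x : Fin n → ℝ => if j ∈ T then 1 - x j else x j)
      (cube n) := by
    intro j
    by_cases hj : j ∈ T
    · simp only [hj, if_true]; exact analyticOnNhd_const.sub (analyticOnNhd_apply n j _)
    · simp only [hj, if_false]; exact analyticOnNhd_apply n j _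
  have h1 : IsSemialgebraicFunOn ℚ (cube n) (fun _ : Fin n → ℝ => (1 : ℝ)) := by
    simpa using isSemialgebraicFunOn_ratCast (isSemialgebraic_cube (n := n)) 1
  have hρs : ∀ j, IsSemialgebraicFunOn ℚ (cube n)
      (fun x : Fin n → ℝ => if j ∈ T then 1 - x j else x j) := by
    intro j
    by_cases hj : j ∈ T
    · simp only [hj, if_true]
      exact h1.fun_sub (isSemialgebraicFunOn_apply isSemialgebraic_cube j)
    · simp only [hj, if_false]; exact isSemialgebraicFunOn_apply isSemialgebraic_cube j
  exact ⟨hρm, hga.comp (AnalyticOnNhd.pi hρa) hρm,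
    IsSemialgebraicFunOn.comp_isSemialgebraicMapOn_holds hgs
      (IsSemialgebraicMapOn.of_forall isSemialgebraic_cube hρs) hρm⟩

/-- **Reflections of a set of coordinates from StokesLast + Sym.** For tame cubes `R, S` with
`R(x) = S(ρ_T x)` on the cube, `[R] − [S] ∈ linStokesSymIdeal`: one reflection generator
(`ReflectionGeneration.of_sub_of_mem`) per coordinate of `T`, through the tame cubes
`[S ∘ ρ_{T'}]`, `T' ⊆ T`. [Ayoub 2014, Def. 10; Kontsevich–Zagier 2001, §1.2 rule (2)] -/
theorem of_sub_of_mem_of_reflections {n : ℕ} (T : Finset (Fin n)) :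
    ∀ {R S : IntegralRep n}, R.IsTameCube → S.IsTameCube →
      (∀ x ∈ cube n, R.integrand x = S.integrand (fun j => if j ∈ T then 1 - x j else x j)) →
      of R - of S ∈ linStokesSymIdeal := by
  induction T using Finset.induction_on with
  | empty =>
    intro R S hR hS h
    exact of_sub_of_mem_of_eqOn hR hS fun x hx => by simpa using h x hx
  | insert a T ha ih =>
    intro R S hR hS h
    obtain ⟨-, hCa, hCs⟩ := reflect_sideConditions T hS.2 hS.isSemialgebraicFunOn
    obtain ⟨R'', hR''d, hR''i⟩ : ∃ R'' : IntegralRep n, R''.domain = cube n ∧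
        R''.integrand = fun x => S.integrand (fun j => if j ∈ T then 1 - x j else x j) :=
      ⟨IntegralRep.tameCube _ hCa hCs, rfl, rfl⟩
    have hR''t : R''.IsTameCube := ⟨hR''d, by rw [hR''i]; exact hCa⟩
    have hrefl : ∀ x ∈ cube n, R.integrand x = R''.integrand (Function.update x a (1 - x a)) := by
      intro x hx
      simp only [h x hx, hR''i]
      congr 1
      funext j
      by_cases hja : j = a
      · subst hja
        simp [ha]
      · simp [Finset.mem_insert, hja]
    have h1 := ReflectionGeneration.of_sub_of_mem a hR hR''t hrefl
    have h2 := ih hR''t hS fun x _ => by rw [hR''i]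
    have h12 := linStokesSymIdeal.add_mem h1 h2
    rwa [sub_add_sub_cancel] at h12

/-- **Hyperoctahedral changes of variables from StokesLast + Sym.** For a permutation `σ`, a set of
flipped coordinates `{j | p j}` and tame cubes `R, S` with
`R(x) = S(j ↦ 1 − x_{σ j} (p j), x_{σ j} (¬ p j))` on the cube, `[R] − [S] ∈ linStokesSymIdeal`:
`[R] ≡ [R''.reindex σ] ≡ [R''] ≡ [S]` with `R'' = [S ∘ ρ]` (congruence, a symmetry generator,
and the reflections). [Ayoub 2014, Def. 10; Kontsevich–Zagier 2001, §1.2 rule (2)] -/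
theorem of_sub_of_mem_of_hyperoctahedral {n : ℕ} (σ : Equiv.Perm (Fin n)) (p : Fin n → Prop)
    [DecidablePred p] {R S : IntegralRep n} (hR : R.IsTameCube) (hS : S.IsTameCube)
    (h : ∀ x ∈ cube n, R.integrand x = S.integrand (fun j => if p j then 1 - x (σ j) else x (σ j))) :
    of R - of S ∈ linStokesSymIdeal := by
  classical
  obtain ⟨T, hT⟩ : ∃ T : Finset (Fin n), ∀ j, j ∈ T ↔ p j :=
    ⟨Finset.univ.filter p, fun j => by simp⟩
  obtain ⟨-, hCa, hCs⟩ := reflect_sideConditions T hS.2 hS.isSemialgebraicFunOn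
  obtain ⟨R'', hR''d, hR''i⟩ : ∃ R'' : IntegralRep n, R''.domain = cube n ∧
      R''.integrand = fun x => S.integrand (fun j => if j ∈ T then 1 - x j else x j) :=
    ⟨IntegralRep.tameCube _ hCa hCs, rfl, rfl⟩
  have hR''t : R''.IsTameCube := ⟨hR''d, by rw [hR''i]; exact hCa⟩
  have hE : EqOn R.integrand (R''.reindex σ).integrand (cube n) := fun x hx => by
    simp only [h x hx, IntegralRep.reindex_integrand, hR''i]
    congr 1
    funext j
    by_cases hj : p j
    · simp [hj, (hT j).2 hj]
    · have hj' : j ∉ T := fun h' => hj ((hT j).1 h')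
      simp [hj, hj']
  have h1 := of_sub_of_mem_of_eqOn hR (isTameCube_reindex hR''t σ) hE
  have h2 := of_sub_of_reindex_mem_linStokesSymIdeal hR''t σ
  have h3 := of_sub_of_mem_of_reflections T hR''t hS fun x _ => by rw [hR''i]
  rw [show of R - of S = (of R - of (R''.reindex σ)) - (of R'' - of (R''.reindex σ)) +
    (of R'' - of S) by abel]
  exact linStokesSymIdeal.add_mem (linStokesSymIdeal.sub_mem h1 h2) h3

/-- Anchor of this helper file (registered sub-goal `stub_covGeneration_face` of crux
stmt-KontsevichZagierPeriods-3929, serving `stub_covGeneration` of line `lin-stokes-sym`): the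
face-preserving change of variables with the signed Jacobian lies in `linStokesSymIdeal`
(`of_sub_of_mem_of_facePreserving`).
[Kontsevich–Zagier 2001, §1.2 rules (1)–(3); Ayoub 2014, Def. 10] -/
theorem stub_covGeneration_face : ∀ (n : ℕ) (Φ : (Fin n → ℝ) → (Fin n → ℝ)) (r₁ r₂ : IntegralRep n), (∀ i, AnalyticOnNhd ℝ (fun x => Φ x i) (KZ.cube n)) → (∀ i, IsSemialgebraicFunOn ℚ (KZ.cube n) (fun x => Φ x i)) → Set.MapsTo Φ (KZ.cube n) (KZ.cube n) → (∀ x ∈ KZ.cube n, ∀ j, x j = 0 → Φ x j = 0) → (∀ x ∈ KZ.cube n, ∀ j, x j = 1 → Φ x j = 1) → r₁.IsTameCube → r₂.IsTameCube → (∀ x ∈ KZ.cube n, r₁.integrand x = r₂.integrand (Φ x) * (fderiv ℝ Φ x).det) → of r₁ - of r₂ ∈ linStokesSymIdeal :=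
  fun _ _ _ _ hΦa hΦs hΦm hface0 hface1 h₁ h₂ hcov =>
    of_sub_of_mem_of_facePreserving hΦa hΦs hΦm hface0 hface1 h₁ h₂ hcov

end CovGeneration

end Summit.KontsevichZagierPeriods.FurushoPentagon.ReducedPeriodRing.LinStokesSym
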